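import Mathlib
import HarnessLib
import Literature.Probability.MarkovChains.DistinguishingStatistic

/-!
HONEST FRAMING: exact (Metropolis-corrected) sampling algorithms for lattice gauge theory; figures
of merit are autocorrelation/cost numbers at stated couplings and volumes; no continuum-physics
claim.

# LadderPoincare — A POINCARÉ INEQUALITY FOR THE UNIFORM LAW ON THE LADDER `0, …, K`:
# `Var_unif(g) ≤ ((K+1)/2)·Σ_{k<K}(g(k+1) − g(k))²`, AND LADDER BOOK-KEEPING (lean-2 GEN-16, ours)

Venture-side (OURS).  Cell `lqcd-flow` (pub-lqcd), unit `pub-lqcd-lean-2-g16`, 2026-08-24.  Elementary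
inequalities used by `Scaling/SimulatedTemperingFiniteGap` to bound the Poincaré constant of the projection
chain of the simulated-tempering sampler (a lazy birth–death walk on the levels `0, …, K` with uniform
stationary law): the variance under the uniform law is controlled by the squared increments along the ladder.
The constant `(K+1)/2` comes from measuring every rung against the MIDDLE rung (distance `≤ (K+1)/2`) and
Cauchy–Schwarz along the connecting segment; the sharp constant (`≈ 2(K+1)²/π²` per unit rate) is not needed.

* `lawVariance_le_sum_sq_sub` — `Var_μ(f) ≤ Σ_x μ(x)(f(x) − c)²` for every constant `c` (probability vector `μ`);
* `sum_Ico_sq_steps_le`; `sq_sub_middle_le` (Cauchy–Schwarz along a segment, as in the tree's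
  `B4Block227.sq_sub_le_Ico`, inlined) — `(u i − u ⌊(K+1)/2⌋)² ≤ ((K+1)/2)·Σ_{k<K}(u(k+1) − u(k))²` for
  `i ≤ K`;
* **`lawVariance_uniform_le_ladder`** — for `g : Fin (K+1) → ℝ`,
  `lawVariance (fun _ => 1/(K+1)) g ≤ ((K+1)/2)·Σ_{k : Fin K}(g k.succ − g k.castSucc)²`;
* `sum_sum_ite_val_succ` / `sum_sum_ite_val_pred` — `Σ_i Σ_j [j = i+1]F(i,j) = Σ_{k<K} F(k,k+1)` and its mirror.

Literature grade (cell rule): TEXTBOOK (path / canonical-path Poincaré inequalities, Levin–Peres–Wilmer §13.4;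
Diaconis–Stroock 1991), NEW TYPING only; nothing cited as a fact; no new bib keys.
-/

noncomputable section

open Finset
open Literature.Probability.MarkovChains

namespace Summit.Ventures.LatticeQCDFlow.Scaling

section Ladder

variable {X : Type*} [Fintype X]

/-- The mean square deviation from ANY constant dominates the variance:
`Var_μ(f) ≤ Σ_x μ(x)(f(x) − c)²` for a probability vector `μ ≥ 0`. [folklore] -/
theorem lawVariance_le_sum_sq_sub {μ : X → ℝ} (hμ1 : ∑ x, μ x = 1) (f : X → ℝ) (c : ℝ) :
    lawVariance μ f ≤ ∑ x, μ x * (f x - c) ^ 2 := by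
  unfold lawVariance lawMean
  set m := ∑ x, μ x * f x with hm
  have h1 : ∑ x, μ x * (f x - m) ^ 2 = ∑ x, μ x * f x ^ 2 - m ^ 2 := by
    have e : ∀ x, μ x * (f x - m) ^ 2 = μ x * f x ^ 2 - 2 * m * (μ x * f x) + m ^ 2 * μ x :=
      fun x => by ring
    simp_rw [e, Finset.sum_add_distrib, Finset.sum_sub_distrib, ← Finset.mul_sum, ← hm, hμ1]
    ring
  have h2 : ∑ x, μ x * (f x - c) ^ 2 = ∑ x, μ x * f x ^ 2 - 2 * c * m + c ^ 2 := by
    have e : ∀ x, μ x * (f x - c) ^ 2 = μ x * f x ^ 2 - 2 * c * (μ x * f x) + c ^ 2 * μ x :=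
      fun x => by ring
    simp_rw [e, Finset.sum_add_distrib, Finset.sum_sub_distrib, ← Finset.mul_sum, ← hm, hμ1]
    ring
  rw [h1, h2]
  nlinarith [sq_nonneg (m - c)]

/-- Squared increments over a sub-interval of the ladder are at most those over the whole ladder. [folklore] -/
theorem sum_Ico_sq_steps_le (u : ℕ → ℝ) {i j K : ℕ} (hj : j ≤ K) :
    ∑ k ∈ Finset.Ico i j, (u (k + 1) - u k) ^ 2 ≤ ∑ k ∈ Finset.range K, (u (k + 1) - u k) ^ 2 := by
  refine Finset.sum_le_sum_of_subset_of_nonneg (fun k hk => ?_) fun k _ _ => sq_nonneg _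
  rw [Finset.mem_Ico] at hk
  rw [Finset.mem_range]
  omega

/-- Distance to the middle rung: `(u i − u m)² ≤ ((K+1)/2)·Σ_{k<K}(u_{k+1} − u_k)²` for `i ≤ K`,
`m = ⌊(K+1)/2⌋`. [folklore] -/
theorem sq_sub_middle_le (u : ℕ → ℝ) {i K : ℕ} (hi : i ≤ K) :
    (u i - u ((K + 1) / 2)) ^ 2 ≤ ((K + 1 : ℝ) / 2) * ∑ k ∈ Finset.range K, (u (k + 1) - u k) ^ 2 := by
  have hS0 : 0 ≤ ∑ k ∈ Finset.range K, (u (k + 1) - u k) ^ 2 := sum_nonneg fun k _ => sq_nonneg _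
  -- Cauchy–Schwarz along a segment of the ladder (the tree's `B4Block227.sq_sub_le_Ico`, inlined)
  have cs : ∀ {i j : ℕ}, i ≤ j →
      (u j - u i) ^ 2 ≤ ((j - i : ℕ) : ℝ) * ∑ k ∈ Finset.Ico i j, (u (k + 1) - u k) ^ 2 := by
    intro i j hij
    rw [← Finset.sum_Ico_sub u hij]
    simpa [Nat.card_Ico] using sq_sum_le_card_mul_sum_sq (s := Finset.Ico i j) (f := fun k => u (k + 1) - u k)
  rcases le_total i ((K + 1) / 2) with h | h
  · -- `i` below the middle
    have h1 := cs h
    have hm : (K + 1) / 2 ≤ K := by omega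
    have h2 := sum_Ico_sq_steps_le u (i := i) hm
    have hd : (((K + 1) / 2 - i : ℕ) : ℝ) ≤ (K + 1 : ℝ) / 2 := by
      have : 2 * ((K + 1) / 2 - i) ≤ K + 1 := by omega
      have : (2 : ℝ) * (((K + 1) / 2 - i : ℕ) : ℝ) ≤ (K + 1 : ℝ) := by exact_mod_cast this
      linarith
    rw [show (u i - u ((K + 1) / 2)) ^ 2 = (u ((K + 1) / 2) - u i) ^ 2 by ring]
    calc (u ((K + 1) / 2) - u i) ^ 2
        ≤ (((K + 1) / 2 - i : ℕ) : ℝ) * ∑ k ∈ Finset.Ico i ((K + 1) / 2), (u (k + 1) - u k) ^ 2 := h1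
      _ ≤ ((K + 1 : ℝ) / 2) * ∑ k ∈ Finset.range K, (u (k + 1) - u k) ^ 2 :=
          mul_le_mul hd h2 (sum_nonneg fun k _ => sq_nonneg _) (by positivity)
  · -- `i` above the middle
    have h1 := cs h
    have h2 := sum_Ico_sq_steps_le u (i := (K + 1) / 2) hi
    have hd : ((i - (K + 1) / 2 : ℕ) : ℝ) ≤ (K + 1 : ℝ) / 2 := by
      have : 2 * (i - (K + 1) / 2) ≤ K + 1 := by omega
      have : (2 : ℝ) * ((i - (K + 1) / 2 : ℕ) : ℝ) ≤ (K + 1 : ℝ) := by exact_mod_cast this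
      linarith
    calc (u i - u ((K + 1) / 2)) ^ 2
        ≤ ((i - (K + 1) / 2 : ℕ) : ℝ) * ∑ k ∈ Finset.Ico ((K + 1) / 2) i, (u (k + 1) - u k) ^ 2 := h1
      _ ≤ ((K + 1 : ℝ) / 2) * ∑ k ∈ Finset.range K, (u (k + 1) - u k) ^ 2 :=
          mul_le_mul hd h2 (sum_nonneg fun k _ => sq_nonneg _) (by positivity)

/-- **Poincaré inequality on the ladder, uniform weights:** for every `g : Fin (K+1) → ℝ`,
`Var_unif(g) ≤ ((K+1)/2)·Σ_{k<K}(g(k+1) − g(k))²`. [folklore] -/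
theorem lawVariance_uniform_le_ladder (K : ℕ) (g : Fin (K + 1) → ℝ) :
    lawVariance (fun _ : Fin (K + 1) => (1 : ℝ) / (K + 1)) g
      ≤ ((K + 1 : ℝ) / 2) * ∑ k : Fin K, (g k.succ - g k.castSucc) ^ 2 := by
  -- extend `g` to `ℕ`
  set u : ℕ → ℝ := fun n => if h : n < K + 1 then g ⟨n, h⟩ else 0 with hu
  have hug : ∀ i : Fin (K + 1), g i = u i := fun i => by rw [hu]; simp [i.2]
  have hS : ∑ k : Fin K, (g k.succ - g k.castSucc) ^ 2 = ∑ k ∈ Finset.range K, (u (k + 1) - u k) ^ 2 := by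
    rw [← Fin.sum_univ_eq_sum_range (fun k => (u (k + 1) - u k) ^ 2) K]
    refine sum_congr rfl fun k _ => ?_
    have h1 : g k.succ = u (k + 1) := by
      rw [hu]; simp only [show (k : ℕ) + 1 < K + 1 by omega, dite_true]; rfl
    have h2 : g k.castSucc = u k := by
      rw [hu]; simp only [show (k : ℕ) < K + 1 by omega, dite_true]; rfl
    rw [h1, h2]
  have hunif : ∑ _i : Fin (K + 1), (1 : ℝ) / (K + 1) = 1 := by
    rw [Finset.sum_const, Finset.card_univ, Fintype.card_fin, nsmul_eq_mul]
    push_cast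
    field_simp
  calc lawVariance (fun _ : Fin (K + 1) => (1 : ℝ) / (K + 1)) g
      ≤ ∑ i : Fin (K + 1), (1 : ℝ) / (K + 1) * (g i - u ((K + 1) / 2)) ^ 2 :=
        lawVariance_le_sum_sq_sub hunif g _
    _ ≤ ∑ _i : Fin (K + 1), (1 : ℝ) / (K + 1)
          * (((K + 1 : ℝ) / 2) * ∑ k ∈ Finset.range K, (u (k + 1) - u k) ^ 2) := by
        refine sum_le_sum fun i _ => mul_le_mul_of_nonneg_left ?_ (by positivity)
        rw [hug i]
        exact sq_sub_middle_le u (Nat.lt_succ_iff.mp i.2)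
    _ = ((K + 1 : ℝ) / 2) * ∑ k : Fin K, (g k.succ - g k.castSucc) ^ 2 := by
        rw [Finset.sum_const, Finset.card_univ, Fintype.card_fin, nsmul_eq_mul, hS]
        push_cast
        field_simp

/-- Book-keeping on the ladder: `Σ_i Σ_j [j = i+1]·F(i,j) = Σ_{k<K} F(k, k+1)`. [folklore] -/
theorem sum_sum_ite_val_succ {K : ℕ} (F : Fin (K + 1) → Fin (K + 1) → ℝ) :
    ∑ i : Fin (K + 1), ∑ j : Fin (K + 1), (if j.val = i.val + 1 then F i j else 0)
      = ∑ k : Fin K, F k.castSucc k.succ := by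
  rw [Finset.sum_comm, Fin.sum_univ_succ]
  have h0 : ∑ i : Fin (K + 1), (if (0 : Fin (K + 1)).val = i.val + 1 then F i 0 else 0) = 0 :=
    Finset.sum_eq_zero fun i _ => by rw [if_neg (by simp)]
  rw [h0, zero_add]
  refine sum_congr rfl fun k _ => ?_
  have hc : ∀ i : Fin (K + 1), (k.succ.val = i.val + 1) ↔ (i = k.castSucc) := by
    intro i
    rw [Fin.ext_iff, Fin.val_succ, Fin.val_castSucc]
    omega
  rw [Finset.sum_congr rfl fun i _ => if_congr (hc i) rfl rfl, Finset.sum_ite_eq' univ k.castSucc,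
    if_pos (mem_univ _)]

/-- The mirror image: `Σ_i Σ_j [i = j+1]·F(i,j) = Σ_{k<K} F(k+1, k)`. [folklore] -/
theorem sum_sum_ite_val_pred {K : ℕ} (F : Fin (K + 1) → Fin (K + 1) → ℝ) :
    ∑ i : Fin (K + 1), ∑ j : Fin (K + 1), (if i.val = j.val + 1 then F i j else 0)
      = ∑ k : Fin K, F k.succ k.castSucc := by
  rw [Finset.sum_comm]
  exact sum_sum_ite_val_succ (fun j i => F i j)

end Ladder

end Summit.Ventures.LatticeQCDFlow.Scaling

end
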